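import Summits.HodgeConjecture.HodgeConjecture.Theorems.Ring2AbelianAllAndreTwistedSquareNonsplit
import Summits.HodgeConjecture.HodgeConjecture.Theorems.Ring2AbelianAllOddTimesOdd
import HarnessLib

/-!
# Ring 2 · AbelianAll — ANDRÉ AXIS, PART O-e: `T × T̄` WITH `dim T` ODD IS ABSOLUTELY SPLIT YET POLARIZED NON-SPLIT —
  the two «non-split sixfold» conventions of the tree differ, and the anchors `B × B̄`, `E³ × Ē³` witness it (bookkeeping for the planners)

HONEST FRAMING (sub-cell `pub-hodge-ring2-ab-*`, verbatim): research route, not a corollary; conditional on HC_CM plus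
one named minimal statement. (Cell `pub-hodge-ring2`, verbatim: research route conditional on HC_CM; not a corollary;
Q11.4-sentence-2 already refuted in dim ≥ 3.) `HC_CM` does not occur in this file. No definition, no named fact, no `sorry`; fact-free,
ABELIAN-VARIETY level. Inputs: part O-a (`isWeilType_twistedSquare`), part O-b (`nonsplit_weilSixfold_twistedSquare`), ab-weil-2's
`isSplitWeilType_prod_of_odd_dim` (both factors of odd dimension ⟹ SOME weighted Segre class is hyperbolic).

THE POINT. The tree carries TWO typed notions of «non-split Weil type»: the ABSOLUTE one of the Hodge–Weil ladder
(`HodgeTheory.IsNonsplitWeilType A φ n d`: NO `K`-symmetrised hyperplane class of `A` is hyperbolic; the hypothesis of the rung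
`WeilTypeLadder.NonsplitSixfolds`) and the POLARIZED one of the cell's component targets (`Ring2.Hypotheses.WeilClassesComponent n d δ`,
`δ ≠ [(−1)ⁿ]`: a FIXED class of discriminant `δ`; also the convention of van Geemen 5.3 / Markman §11.5 Step 1 and of the André-axis pencils,
whose relative polarization has a constant class — parts L-a / O-c). For the twisted square `T × T̄ = (T × T, φ × (−φ))` of a `(2k+1)`-fold:

* §1 **`isSplitWeilType_twistedSquare_of_odd` — `T × T̄` is of SPLIT Weil type in the absolute sense** (Weil type by part O-a; then ab-weil-2:
  the weight-`M` Segre class with `M = |num C|·den C` is hyperbolic), hence **`not_isNonsplitWeilType_twistedSquare_of_odd`**: it is NOT absolutely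
  non-split — the rung `NonsplitSixfolds` says nothing at `B × B̄` or `E³ × Ē³` (its hypothesis fails there), although their Weil classes are algebraic.
* §2 **`twistedSquare_absolutelySplit_and_polarizedNonsplit`** — yet for every `m ∉ Nm(K_dˣ)` the weight-`m` class is NOT hyperbolic (part O-b): ONE
  abelian variety with `K`-action carrying a hyperbolic `K`-symmetrised polarization AND a non-hyperbolic one of class `[−m]`. So «non-split» in
  RING2-MAP's W₆ instance (pencils through `B × B̄` on the component `(3, d, [−m])`) is the POLARIZED notion, and the absolute rung `NonsplitSixfolds`
  and the polarized targets `WeilClassesComponent 3 d δ` are DIFFERENT statements member by member (they agree on members of Néron–Severi rank one,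
  which the carriers do not see).

Nothing here is a case of the Hodge conjecture; nothing minimal claimed; N104 untouched.

## References

* [vanGeemen1994HodgeAV] B. van Geemen, LNM 1594 (1994), Lemma 5.2 (3), 5.3–5.4 and (5.4.1).
* [Landherr1936HermitianForms] W. Landherr, Abh. Math. Sem. Hamburg 11 (1936) 245–248.
* [Markman2025SurveySecant] E. Markman, arXiv:2509.23403 (unrefereed), §1.1 and §11.5 Step 1.
* [MoonenZarhin1999LowDim] B. Moonen, Yu. Zarhin, Math. Ann. 315 (1999), Thm. 0.1 and §5.
-/

set_option linter.dupNamespace false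

noncomputable section

open CategoryTheory
open Literature.AlgebraicGeometry Literature.AlgebraicGeometry.Motives
open Literature.AlgebraicGeometry.HodgeTheory Literature.AlgebraicGeometry.VanGeemen1994
open Literature.AlgebraicTopology.SingularHomology

namespace Summit.HodgeConjecture.HodgeConjecture.Ring2.AbelianAll

variable {T : AbelianVariety ℂ} {k d : ℕ} {φ : T ⟶ T}

/-! ## §1 Absolutely split -/

/-- **`T × T̄` IS OF SPLIT WEIL TYPE (absolute convention) for `dim T = 2k + 1 ≥ 3`**: it is of Weil type `(2k+1, d)` (part O-a), both factors
have odd dimension, so ab-weil-2's factorwise-rescaling theorem produces a hyperbolic weighted Segre class.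
[cite: vanGeemen1994HodgeAV, Lemma 5.2 (3), 5.4 and (5.4.1)] [cite: Landherr1936HermitianForms] [cite: MoonenZarhin1999LowDim, Thm. 0.1 and §5] -/
theorem isSplitWeilType_twistedSquare_of_odd (hk : 1 ≤ k) (hT : T.dim = 2 * k + 1) (hd : 0 < d) (hφ : φ ≫ φ = -(d • 𝟙 T)) :
    IsSplitWeilType (T.prod T)
      (AbelianVariety.prodLift (AbelianVariety.fst T T ≫ φ) (AbelianVariety.snd T T ≫ (-φ))) (2 * k + 1) d :=
  isSplitWeilType_prod_of_odd_dim hT hT (by omega) (by omega) ⟨k, by ring⟩ (by ring) hd hφ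
    (by rw [Preadditive.neg_comp_neg, hφ]) (isWeilType_twistedSquare (by omega) hT hd hφ)

/-- … hence **`T × T̄` is NOT absolutely non-split**: the hypothesis of the ladder's rung `NonsplitSixfolds` (no hyperbolic `K`-symmetrised
hyperplane class at all) FAILS at every twisted square of an odd-dimensional `T` — at `B × B̄`, `E³ × Ē³`, the Picard-type twisted squares.
[cite: vanGeemen1994HodgeAV, Lemma 5.2 (3) and (5.4.1)] -/
theorem not_isNonsplitWeilType_twistedSquare_of_odd (hk : 1 ≤ k) (hT : T.dim = 2 * k + 1) (hd : 0 < d) (hφ : φ ≫ φ = -(d • 𝟙 T)) :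
    ¬ IsNonsplitWeilType (T.prod T)
      (AbelianVariety.prodLift (AbelianVariety.fst T T ≫ φ) (AbelianVariety.snd T T ≫ (-φ))) (2 * k + 1) d :=
  (isSplitWeilType_twistedSquare_of_odd hk hT hd hφ).not_isNonsplitWeilType

/-! ## §2 … yet polarized non-split -/

/-- **ABSOLUTELY SPLIT AND POLARIZED NON-SPLIT AT ONCE.** For every abelian THREEFOLD `T` with `φ² = −d` and every `m ≥ 1` with `m ∉ Nm(K_dˣ)`:
`(T × T, φ × (−φ))` is of SPLIT Weil type `(3, d)` in the absolute convention (SOME `K`-symmetrised hyperplane class is hyperbolic), AND some OTHER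
`K`-symmetrised hyperplane class `h` (the weight-`m` Segre class) has discriminant class `[−m] ≠ [−1]` and is NOT hyperbolic — the polarized pair
`(T × T̄, h)` lies on the non-split component `(3, d, [−m])`. The absolute rung `NonsplitSixfolds` and the polarized targets
`WeilClassesComponent 3 d δ` are therefore different statements at such members. [cite: vanGeemen1994HodgeAV, Lemma 5.2 (3), 5.3–5.4 and (5.4.1)]
[cite: Markman2025SurveySecant, §11.5 Step 1] -/
theorem twistedSquare_absolutelySplit_and_polarizedNonsplit (hT : T.dim = 3) (hd : 0 < d) (hφ : φ ≫ φ = -(d • 𝟙 T))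
    {m : ℕ} (hm : 0 < m) (hnorm : Units.mk0 (m : ℚ) (Nat.cast_ne_zero.2 hm.ne') ∉ normUnitsSubgroup ℚ (weilField d)) :
    IsSplitWeilType (T.prod T)
        (AbelianVariety.prodLift (AbelianVariety.fst T T ≫ φ) (AbelianVariety.snd T T ≫ (-φ))) 3 d ∧
      ∃ (e : ProjectiveEmbedding (T.prod T).X) (a : complexBetti (projectiveSpace e.n ℂ) 2),
        IsRationalClass a ∧ a ≠ 0 ∧
        HasWeilDiscriminantNondeg (T.prod T)
          (AbelianVariety.prodLift (AbelianVariety.fst T T ≫ φ) (AbelianVariety.snd T T ≫ (-φ))) 3 d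
          ((d : ℂ) • complexBetti.map e.ι 2 a +
            complexBetti.map (AbelianVariety.prodLift (AbelianVariety.fst T T ≫ φ)
              (AbelianVariety.snd T T ≫ (-φ))).hom.hom.hom 2 (complexBetti.map e.ι 2 a))
          (QuotientGroup.mk (-Units.mk0 (m : ℚ) (Nat.cast_ne_zero.2 hm.ne'))) ∧
        ¬ IsHyperbolicWeilType (T.prod T)
            (AbelianVariety.prodLift (AbelianVariety.fst T T ≫ φ) (AbelianVariety.snd T T ≫ (-φ))) 3
            ((d : ℂ) • complexBetti.map e.ι 2 a +
              complexBetti.map (AbelianVariety.prodLift (AbelianVariety.fst T T ≫ φ)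
                (AbelianVariety.snd T T ≫ (-φ))).hom.hom.hom 2 (complexBetti.map e.ι 2 a)) := by
  have hT' : T.dim = 2 * 1 + 1 := by rw [hT]
  obtain ⟨e, a, ha, ha0, -, hδ, -, hnh, -⟩ := nonsplit_weilSixfold_twistedSquare hT hd hφ hm hnorm
  exact ⟨isSplitWeilType_twistedSquare_of_odd (k := 1) le_rfl hT' hd hφ, e, a, ha, ha0, hδ, hnh⟩

end Summit.HodgeConjecture.HodgeConjecture.Ring2.AbelianAll

end
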